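import Mathlib.Data.Nat.Size
import Mathlib.GroupTheory.OrderOfElement
import Mathlib.Data.ZMod.Basic
import Mathlib.Algebra.Field.ZMod
import Literature.Computability.Cryptography.DLogHalf
import Literature.Computability.Cryptography.OracleGames
import HarnessLib

/-!
# Blum–Micali: the half predicate of the discrete logarithm is as hard as the discrete logarithm

Trunk T-CRYPTO (Literature/Computability/Cryptography); cite item `wi-03601` (route
QuantumAdvantage/AvgCase, crux #2, hypothesis next to `Literature.Computability.Cryptography.DLOGHalf`).

Blum–Micali's predicate `B_{p,g}` on `ℤ_p^*` (`p` prime, `g` a generator): `B_{p,g}(x) = 1` iff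
`x` is the `g`-principal square root of `x² mod p`, i.e. (their Remark 1) iff `x = g^s mod p`
with `1 ≤ s ≤ (p-1)/2` (indices normalised to `[1, p-1]`). Their Theorem 3 says that an oracle
("magic box") answering `B_{p,g}(x)` correctly for a fraction `≥ 1/2 + 1/Q(|p|)` of the
`x ∈ ℤ_p^*` yields a probabilistic polynomial-time oracle algorithm solving the discrete
logarithm problem mod `p` for EVERY `y ∈ ℤ_p^*` (random self-reduction `y ↦ y·g^r`, majority
vote, square-root descent, and guessing the `t`-initial segment containing the index).

* `Literature.PQC.bmHalfPredicate p g x : Bool` — `B_{p,g}(x)` as printed (Remark 1 form).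
* `Literature.PQC.bmAgreement O p g : ℕ` — the number of `x ∈ [1, p)` on which the oracle `O`,
  queried on the encoded triple `encodeDLogInstance p g x`, answers `encodeBool (B_{p,g}(x))`.
* `Literature.PQC.oracleDLogSuccessProb R O coins fuel p g y : ℝ` — the probability, over uniformly
  random coins, that the randomised oracle algorithm `R` (G01 `OracleAlg`, run by
  `OracleAlg.randRun`) with oracle `O` outputs `some (encodeNat a)` with `a` the discrete
  logarithm of `y` (`a ∈ dlogSolutions p g y`).
* `Literature.PQC.blumMicali_halfPredicate_dlog : Prop` — the named fact (Theorem 3).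

## The statement vendored, and two documented deviations from the printed sentence

Printed (Blum–Micali 1984, §3.3, Theorem 3, p. 858): *Let `Q` be a polynomial. Let
`MB_Q[·,·,·]` be an oracle such that, for all primes `p` and all generators `g` for `ℤ_p^*`,
`MB_Q[p,g,x] = B_{p,g}(x)` for a fraction at least `1/2 + 1/Q(|p|)` of the `x ∈ ℤ_p^*`. Then
there is a probabilistic algorithm with oracle `MB_Q` that, for all primes `p`, solves the DLP
mod `p` in expected `poly(|p|)` time.* (`|p|` = binary length of `p`; "solves the DLP" = for
any generator `g` and any `y ∈ ℤ_p^*` outputs `index_g(y)`, §3 first paragraph, p. 857.)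

1. **Per-`(p,g)` hypothesis.** The first sentence of the printed proof (p. 860) is: "The
   following probabilistic `poly(|p|)` time algorithm finds `index_g(y) mod p` for any
   `y ∈ ℤ_p^*` by only making calls to the oracle `MB_Q[p, g, ·]`" (likewise Lemma 1, p. 858:
   "We actually prove a stronger result … only making use of the more restricted oracle
   `MB[p, g, ·]`"). Hence the algorithm's behaviour on input `(p, g, y)` depends on the oracle
   only through its answers on triples `(p, g, ·)`, and the conclusion for `(p, g)` needs the
   `1/2 + 1/Q(|p|)` agreement for that pair only. We state this per-pair form (it is what the
   route needs: a fixed sequence `(p_n, g_n)`), quantified `∀ O p g`.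
2. **Monte-Carlo truncation.** The tree's oracle algorithms run with a polynomial round budget
   (`OracleAlg.randRun … fuel`); "expected polynomial time, always correct" is replaced by its
   Markov-inequality consequence "polynomial budget, correct with probability `≥ 2/3`" (run for
   three times the expected time). This is weaker than the printed conclusion.

Everything else is as printed: deterministic `{0,1}`-valued oracle (a wrong-format answer just
counts as a disagreement), agreement counted over uniform `x ∈ ℤ_p^* = [1, p)`, one algorithm
for each polynomial `Q`, all primes `p` (for `p = 2` the hypothesis and conclusion are trivial).

## Relation to `DLOGHalf`

`DLOGHalf` normalises indices to `a ∈ [0, p-1)` and asks `2a < p-1`, Blum–Micali normalise to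
`s ∈ [1, p-1]` and ask `2s ≤ p-1`; the two predicates differ exactly at `y = 1` and (for odd
`p`) `y = -1`, and are related by the shift `DLOGHalf(p,g,y) = B_{p,g}(g·y mod p)` (a bijection
of `ℤ_p^*`, so oracle agreement fractions are preserved). We record the value of `B_{p,g}` on
powers of `g` (`bmHalfPredicate_pow`).

## How the route is expected to use it (not vendored)

A randomised predictor `P(x; r)` with advantage over `(x, r)` is not literally a deterministic
oracle; the standard bridge is problem-side: for a `≥ ε/2` fraction of coin strings `r` the
deterministic oracle `O_r = P(·; r)` has advantage `≥ ε/2` (averaging), discrete logarithms are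
verifiable by one modular exponentiation, so sampling `r`, running the reduction with `Q ↦ 2Q`
and checking the candidate, `O(1/ε)` times, gives a PPT solver correct on every `y` with
probability `≥ 2/3`. Blum–Micali make the same remark for uniform adversaries (§3.2, p. 857).

## References

* M. Blum, S. Micali, *How to generate cryptographically strong sequences of pseudo-random
  bits*, SIAM J. Comput. 13 (1984) 850–864: §3 (DLP, p. 857), §3.3 Definition and Remark 1
  (`B_{p,g}`, p. 858), Theorem 3 (p. 858), Lemmas 1–3 and proof of Theorem 3 (pp. 858–861).
  Read from the authors' copy (people.csail.mit.edu/silvio/Selected Scientific Papers).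
* E. Kranakis, *Primality and Cryptography*, Wiley–Teubner 1986, §4.10, Theorems 4.18–4.21
  (the same reduction, circuit version).
* S. Arora, B. Barak, *Computational Complexity*, CUP 2009, §3.4 with Def. 7.1 (probabilistic
  oracle machines) — the model behind `OracleAlg.randRun`.
-/

noncomputable section

namespace Literature.Computability.Cryptography

open _root_.Computability Complexity

/-! ### The Blum–Micali predicate -/

/-- The Blum–Micali predicate `B_{p,g}(x)`: `true` iff `x ≡ g^s (mod p)` for some index
`1 ≤ s ≤ (p-1)/2`, i.e. iff `x` is the `g`-principal square root of `x² mod p` (indices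
normalised to `[1, p-1]`). [Blum–Micali 1984, §3.3, Definition of `B_{p,g}` and Remark 1,
p. 858] [cite: BlumMicali1984, §3.3 Remark 1] -/
def bmHalfPredicate (p g x : ℕ) : Bool :=
  decide (∃ s ∈ Finset.Icc 1 ((p - 1) / 2), g ^ s ≡ x [MOD p])

/-- Unfolding of `bmHalfPredicate`. [Blum–Micali 1984, §3.3 Remark 1] [cite: BlumMicali1984, §3.3 Remark 1] -/
theorem bmHalfPredicate_eq_true_iff (p g x : ℕ) :
    bmHalfPredicate p g x = true ↔ ∃ s, 1 ≤ s ∧ 2 * s ≤ p - 1 ∧ g ^ s ≡ x [MOD p] := by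
  simp only [bmHalfPredicate, decide_eq_true_eq, Finset.mem_Icc]
  constructor
  · rintro ⟨s, ⟨h1, h2⟩, h3⟩
    exact ⟨s, h1, by omega, h3⟩
  · rintro ⟨s, h1, h2, h3⟩
    exact ⟨s, ⟨h1, by omega⟩, h3⟩

/-- On powers of a generator: for `p` prime and `g` of order `p - 1` in `(ℤ/p)^*` (as in
`IsDLogInstance p g ·`) and an index `1 ≤ s ≤ p - 1`, `B_{p,g}(g^s mod p) = [2s ≤ p-1]`.
[Blum–Micali 1984, §3.3 Remark 1 ("given `s` such that `x = g^s mod p` … check whether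
`s ≤ (p-1)/2`")] [cite: BlumMicali1984, §3.3 Remark 1] -/
theorem bmHalfPredicate_pow {p g : ℕ} (hg : IsDLogInstance p g 1) {s : ℕ} (hs1 : 1 ≤ s)
    (hsp : s ≤ p - 1) :
    bmHalfPredicate p g (g ^ s % p) = decide (2 * s ≤ p - 1) := by
  obtain ⟨hp, hg0, hgp, hord, -, -⟩ := hg
  haveI : NeZero p := ⟨hp.ne_zero⟩
  haveI : Fact p.Prime := ⟨hp⟩
  rw [Bool.eq_iff_iff, bmHalfPredicate_eq_true_iff, decide_eq_true_eq]
  constructor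
  · rintro ⟨s', h1', h2', hmod⟩
    -- `g^s' ≡ g^s (mod p)` forces `s' ≡ s (mod p-1)`, hence `s' = s` as both lie in `[1, p-1]`.
    have hmod' : g ^ s' ≡ g ^ s [MOD p] := hmod.trans (Nat.mod_modEq _ _)
    have hz : ((g : ZMod p)) ^ s' = (g : ZMod p) ^ s := by
      have := (ZMod.natCast_eq_natCast_iff _ _ p).mpr hmod'
      push_cast at this
      exact this
    -- pass to the unit group, where powers are injective modulo the order
    have hgz : (g : ZMod p) ≠ 0 := fun h0 => by
      rw [ZMod.natCast_eq_zero_iff] at h0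
      exact absurd (Nat.le_of_dvd hg0 h0) (not_le.mpr hgp)
    set u : (ZMod p)ˣ := Units.mk0 (g : ZMod p) hgz with hu
    have hordu : orderOf u = p - 1 := by rw [← orderOf_units]; simpa [u] using hord
    have huz : u ^ s' = u ^ s := Units.ext (by simpa [u] using hz)
    rw [pow_eq_pow_iff_modEq, hordu] at huz
    -- both in `[1, p-1]`: equal
    have hs's : s' = s := by
      have hlt : s' < p - 1 := by omega
      rcases Nat.lt_or_ge s (p - 1) with hlt2 | hge2
      · rw [Nat.ModEq, Nat.mod_eq_of_lt hlt, Nat.mod_eq_of_lt hlt2] at huz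
        exact huz
      · -- `s = p - 1`, then `s' ≡ 0`, impossible with `1 ≤ s' < p-1`
        have hs : s = p - 1 := le_antisymm hsp hge2
        subst hs
        rw [Nat.ModEq, Nat.mod_eq_of_lt hlt, Nat.mod_self] at huz
        omega
    subst hs's
    exact h2'
  · intro h
    exact ⟨s, hs1, h, Nat.mod_modEq _ _ |>.symm⟩

/-! ### Oracle agreement and success probability -/

/-- `bmAgreement O p g`: the number of `x ∈ [1, p)` (i.e. `x ∈ ℤ_p^*`) on which the oracle `O`,
queried on the encoded triple `(p, g, x)`, returns the (one-symbol encoding of the) correct bit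
`B_{p,g}(x)`. The printed hypothesis "`MB[p,g,x] = B_{p,g}(x)` for a fraction at least
`1/2 + 1/Q(|p|)` of the `x ∈ ℤ_p^*`" reads `(1/2 + 1/Q(|p|))·(p-1) ≤ bmAgreement O p g`.
[Blum–Micali 1984, §3.3, Theorem 3 (hypothesis)] [cite: BlumMicali1984, Theorem 3] -/
def bmAgreement (O : Oracle) (p g : ℕ) : ℕ :=
  ((Finset.Ico 1 p).filter fun x =>
    O (encodeDLogInstance p g x) = encodeBool (bmHalfPredicate p g x)).card

/-- The agreement count is at most `p - 1 = |ℤ_p^*|`. [Blum–Micali 1984, §3.3] [folklore] -/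
theorem bmAgreement_le (O : Oracle) (p g : ℕ) : bmAgreement O p g ≤ p - 1 := by
  unfold bmAgreement
  exact (Finset.card_filter_le _ _).trans (by simp)

/-- `oracleDLogSuccessProb R O coins fuel p g y`: the probability, over uniform coins
`r ∈ {0,1}^{coins(|x|)}` (`x = encodeDLogInstance p g y`), that the oracle algorithm `R` with
oracle `O`, run for `fuel(|x|)` rounds on `boolPair x r` (`OracleAlg.randRun`), halts with
output `some (encodeNat a)` where `a` is the discrete logarithm of `y` to base `g` mod `p`
(`a ∈ dlogSolutions p g y`). [Blum–Micali 1984, §3 ("solves the DLP", p. 857); Arora–Barak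
2009, Def. 7.1 with §3.4] [cite: BlumMicali1984, §3] -/
def oracleDLogSuccessProb (R : OracleAlg (List Bool)) (O : Oracle) (coins fuel : Polynomial ℕ)
    (p g y : ℕ) : ℝ :=
  ((R.randRun O coins fuel (encodeDLogInstance p g y)).toOuterMeasure
    {o | ∃ a ∈ dlogSolutions p g y, o = some (encodeNat a)}).toReal

/-- A success probability is at most `1`. [Mathlib `PMF.coe_le_one`] [folklore] -/
theorem oracleDLogSuccessProb_le_one (R : OracleAlg (List Bool)) (O : Oracle)
    (coins fuel : Polynomial ℕ) (p g y : ℕ) :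
    oracleDLogSuccessProb R O coins fuel p g y ≤ 1 := by
  unfold oracleDLogSuccessProb
  refine ENNReal.toReal_le_of_le_ofReal zero_le_one ?_
  rw [ENNReal.ofReal_one]
  set μ := (R.randRun O coins fuel (encodeDLogInstance p g y)).toOuterMeasure
  calc μ {o | ∃ a ∈ dlogSolutions p g y, o = some (encodeNat a)}
      ≤ μ Set.univ := μ.mono (Set.subset_univ _)
    _ = 1 := (PMF.toOuterMeasure_apply_eq_one_iff _ _).2 (Set.subset_univ _)

/-- A success probability is nonnegative. [folklore] -/
theorem oracleDLogSuccessProb_nonneg (R : OracleAlg (List Bool)) (O : Oracle)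
    (coins fuel : Polynomial ℕ) (p g y : ℕ) :
    0 ≤ oracleDLogSuccessProb R O coins fuel p g y :=
  ENNReal.toReal_nonneg

/-! ### The named fact -/

/-- **Blum–Micali 1984, Theorem 3** (the half predicate is as hard as the discrete logarithm;
per-`(p,g)` form of the printed proof, Monte-Carlo truncation — see the module docstring).
For every polynomial `Q` (positive values) there are a polynomial-time oracle algorithm `R`
(step function polynomial-time, `OracleAlg.IsPolyTime`) and polynomial coin and round budgets
such that: for every oracle `O`, every prime `p` with generator `g` of `ℤ_p^*` and every unit
`y` (`IsDLogInstance p g y`), if `O` answers `B_{p,g}(x)` correctly on at least a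
`1/2 + 1/Q(|p|)` fraction of the `x ∈ ℤ_p^*` (`|p| = Nat.size p`, the binary length), then
`R^O` on input the encoding of `(p, g, y)` outputs the discrete logarithm `index_g(y)` with
probability at least `2/3` over its coins. [cite: BlumMicali1984, Theorem 3] -/
def blumMicali_halfPredicate_dlog : Prop :=
  ∀ Q : Polynomial ℕ, (∀ n, 0 < Q.eval n) →
    ∃ (R : OracleAlg (List Bool)) (coins fuel : Polynomial ℕ),
      R.IsPolyTime (encodingList Bool) ∧
      ∀ (O : Oracle) (p g y : ℕ), IsDLogInstance p g y →
        ((1 : ℝ) / 2 + 1 / ((Q.eval p.size : ℕ) : ℝ)) * ((p - 1 : ℕ) : ℝ) ≤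
            (bmAgreement O p g : ℝ) →
          (2 : ℝ) / 3 ≤ oracleDLogSuccessProb R O coins fuel p g y

end Literature.Computability.Cryptography

end
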